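import Summits.AtomisticToContinuum.Crystallization.Theorems.OverbindingBudgetAffineTaylorCellModel

/-!
# OverbindingBudget — Taylor-model cells for the far-window certificate, part 3/16 «Accumulator»

MODULE PLAN (lens-4 g68, at hand-2's landing-shape request of 2026-09-02T14:19Z, critic row 1199 (II)) of the VERIFIED g67 leaf
`OverbindingBudgetAffineTaylorCell.lean` (sha256 `dabedef39e0c5fd2…`, 4214 l, critic row 1196): this module = leaf l.529–825
(§3 per-term data, one-pass accumulator, closed forms, rounding envelopes), body VERBATIM except as listed in `MAP.md`.
Same namespace `…Theorems.OverbindingBudgetAffineTaylorCell` in all 16 parts (declaration names unchanged); the parts import each other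
linearly.  No `sorry`, no `native_decide`, standard axioms; no instances/notation; scoped `set_option maxHeartbeats` with explicit bounds only.
-/

namespace Summit.AtomisticToContinuum.Crystallization.Theorems.OverbindingBudgetAffineTaylorCell

/-! ### Per-term data and the one-pass accumulator

`x y z` are the integer coordinates `N` cast to `ℚ`.  The step is UNIFORM (an inadmissible term, `c ≤ 0`, contributes `0` and clears
`ok`), so that the accumulator has the closed forms `acc_coef` / `acc_rem` / `acc_ok_iff` below. -/

/-- `c = Nᵀ G_c N / 9`. -/
def Cell.cOf (C : Cell) (x y z : ℚ) : ℚ := C.Gc.form x y z / 9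
/-- `ℓ_j = Nᵀ M_j N / 9` = the derivative of `s_N` along the cell's `j`-th direction matrix (axis-aligned:
`(2xy, 2xz, y², 2yz, z²)/9` = `∂ (Nᵀ G N / 9) / ∂ G_i` for the free entries `(G₀₁, G₀₂, G₁₁, G₁₂, G₂₂)`). -/
def Cell.l1Of (C : Cell) (x y z : ℚ) : ℚ := C.dir.m1.form x y z / 9
/-- `Cell.l2Of` (docstring added by the landing lane; see the module docstring). [formal bookkeeping] -/
def Cell.l2Of (C : Cell) (x y z : ℚ) : ℚ := C.dir.m2.form x y z / 9
/-- `Cell.l3Of` (docstring added by the landing lane; see the module docstring). [formal bookkeeping] -/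
def Cell.l3Of (C : Cell) (x y z : ℚ) : ℚ := C.dir.m3.form x y z / 9
/-- `Cell.l4Of` (docstring added by the landing lane; see the module docstring). [formal bookkeeping] -/
def Cell.l4Of (C : Cell) (x y z : ℚ) : ℚ := C.dir.m4.form x y z / 9
/-- `Cell.l5Of` (docstring added by the landing lane; see the module docstring). [formal bookkeeping] -/
def Cell.l5Of (C : Cell) (x y z : ℚ) : ℚ := C.dir.m5.form x y z / 9

/-- `Cell.l1Of_std` (docstring added by the landing lane; see the module docstring). [formal bookkeeping] -/
theorem Cell.l1Of_std (C : Cell) (hd : C.dir = Dir5.std) (x y z : ℚ) : C.l1Of x y z = 2 * x * y / 9 := by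
  simp [Cell.l1Of, hd, Dir5.std, QF0.form]
/-- `Cell.l3Of_std` (docstring added by the landing lane; see the module docstring). [formal bookkeeping] -/
theorem Cell.l3Of_std (C : Cell) (hd : C.dir = Dir5.std) (x y z : ℚ) : C.l3Of x y z = y * y / 9 := by
  simp [Cell.l3Of, hd, Dir5.std, QF0.form]
/-- `U = Σ|ℓ_i| h_i / c`: the bound on `|ℓ(t)/c|` over the box `|t_i| ≤ h_i`. -/
def Cell.UOf (C : Cell) (x y z : ℚ) : ℚ :=
  (|C.l1Of x y z| * C.h1 + |C.l2Of x y z| * C.h2 + |C.l3Of x y z| * C.h3 + |C.l4Of x y z| * C.h4 + |C.l5Of x y z| * C.h5)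
    / C.cOf x y z
/-- Exact coefficient contribution of one term to the monomial slot `mo`: `a_d(m) · c^{-m-d} · mult(α) · ℓ^α`. -/
def Cell.termQ (C : Cell) (x y z : ℚ) (mo : Mono) : ℚ :=
  tcoef C.m mo.d * (1 / C.cOf x y z) ^ (C.m + mo.d) * mo.mult *
    (C.l1Of x y z ^ mo.e1 * C.l2Of x y z ^ mo.e2 * C.l3Of x y z ^ mo.e3 * C.l4Of x y z ^ mo.e4 * C.l5Of x y z ^ mo.e5)
/-- Exact remainder contribution of one term: `c^{-m} U^J N_J(U) / (1−U)^m`. -/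
def Cell.remQ (C : Cell) (x y z : ℚ) : ℚ :=
  (1 / C.cOf x y z) ^ C.m * C.UOf x y z ^ C.J * remNum C.m C.J (C.UOf x y z) / (1 - C.UOf x y z) ^ C.m
/-- Admissibility of a term: `c > 0` and `U < 1/2`. -/
def Cell.okTerm (C : Cell) (N : ℤ × ℤ × ℤ) : Bool :=
  decide (0 < C.cOf N.1 N.2.1 N.2.2) && decide (C.UOf N.1 N.2.1 N.2.2 < 1 / 2)
/-- Rounded (DOWN) coefficient contribution; `0` for an inadmissible term or a slot of degree `≥ J`. -/
def Cell.rc (C : Cell) (N : ℤ × ℤ × ℤ) (mo : Mono) : ℚ :=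
  if C.cOf N.1 N.2.1 N.2.2 ≤ 0 then 0
  else if mo.d < C.J then rdn C.D (C.termQ N.1 N.2.1 N.2.2 mo) else 0
/-- Rounded (UP) remainder contribution; `0` for an inadmissible term. -/
def Cell.rr (C : Cell) (N : ℤ × ℤ × ℤ) : ℚ :=
  if C.cOf N.1 N.2.1 N.2.2 ≤ 0 then 0 else rup C.D (C.remQ N.1 N.2.1 N.2.2)

/-- One accumulation step (uniform in the term). -/
def Cell.step (C : Cell) (A : Acc) (N : ℤ × ℤ × ℤ) : Acc :=
  { coef := List.zipWith (fun a mo => a + C.rc N mo) A.coef monos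
    rem := A.rem + C.rr N
    umax := max A.umax (C.UOf N.1 N.2.1 N.2.2)
    ok := A.ok && C.okTerm N }

/-- `Acc.init` (docstring added by the landing lane; see the module docstring). [formal bookkeeping] -/
def Acc.init : Acc := { coef := monos.map fun _ => 0, rem := 0, umax := 0, ok := true }

/-- The accumulator of a finite integer family. -/
def Cell.acc (C : Cell) (vs : List (ℤ × ℤ × ℤ)) : Acc := vs.foldl C.step Acc.init

/-! ### Closed forms of the accumulator (structural soundness of the one-pass kernel) -/

/-- `zipWith_map_self` (docstring added by the landing lane; see the module docstring). [formal bookkeeping] -/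
theorem zipWith_map_self {α β γ : Type*} (F : β → α → γ) (f : α → β) (l : List α) :
    List.zipWith F (l.map f) l = l.map fun a => F (f a) a := by
  induction l with
  | nil => rfl
  | cons a l ih => simp [ih]

/-- `Cell.foldl_coef` (docstring added by the landing lane; see the module docstring). [formal bookkeeping] -/
theorem Cell.foldl_coef (C : Cell) (vs : List (ℤ × ℤ × ℤ)) :
    ∀ (A : Acc) (f : Mono → ℚ), A.coef = monos.map f →
      (vs.foldl C.step A).coef = monos.map fun mo => f mo + (vs.map fun N => C.rc N mo).sum := by
  induction vs with
  | nil =>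
    intro A f hA
    simpa using hA
  | cons N vs ih =>
    intro A f hA
    rw [List.foldl_cons]
    have hstep : (C.step A N).coef = monos.map fun mo => f mo + C.rc N mo := by
      show List.zipWith (fun a mo => a + C.rc N mo) A.coef monos = _
      rw [hA, zipWith_map_self]
    rw [ih (C.step A N) (fun mo => f mo + C.rc N mo) hstep]
    congr 1
    funext mo
    simp [add_assoc]

/-- CLOSED FORM: the `k`-th coefficient is the sum over the family of the rounded contributions to slot `monos[k]`. -/
theorem Cell.acc_coef (C : Cell) (vs : List (ℤ × ℤ × ℤ)) :
    (C.acc vs).coef = monos.map fun mo => (vs.map fun N => C.rc N mo).sum := by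
  have h := C.foldl_coef vs Acc.init (fun _ => 0) rfl
  unfold Cell.acc
  rw [h]
  simp

/-- `Cell.foldl_rem` (docstring added by the landing lane; see the module docstring). [formal bookkeeping] -/
theorem Cell.foldl_rem (C : Cell) (vs : List (ℤ × ℤ × ℤ)) :
    ∀ A : Acc, (vs.foldl C.step A).rem = A.rem + (vs.map C.rr).sum := by
  induction vs with
  | nil => intro A; simp
  | cons N vs ih =>
    intro A
    rw [List.foldl_cons, ih]
    show A.rem + C.rr N + _ = _
    simp [add_assoc]

/-- `Acc.init_rem` (docstring added by the landing lane; see the module docstring). [formal bookkeeping] -/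
theorem Acc.init_rem : Acc.init.rem = 0 := rfl
/-- `Acc.init_ok` (docstring added by the landing lane; see the module docstring). [formal bookkeeping] -/
theorem Acc.init_ok : Acc.init.ok = true := rfl

/-- CLOSED FORM: the remainder slot is the sum of the rounded-up remainder contributions. -/
theorem Cell.acc_rem (C : Cell) (vs : List (ℤ × ℤ × ℤ)) : (C.acc vs).rem = (vs.map C.rr).sum := by
  unfold Cell.acc
  rw [C.foldl_rem vs Acc.init, Acc.init_rem, zero_add]

/-- `Cell.foldl_ok` (docstring added by the landing lane; see the module docstring). [formal bookkeeping] -/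
theorem Cell.foldl_ok (C : Cell) (vs : List (ℤ × ℤ × ℤ)) :
    ∀ A : Acc, (vs.foldl C.step A).ok = (A.ok && vs.all C.okTerm) := by
  induction vs with
  | nil => intro A; simp
  | cons N vs ih =>
    intro A
    rw [List.foldl_cons, ih]
    show (A.ok && C.okTerm N && _) = _
    simp [Bool.and_assoc]

/-- CLOSED FORM: `ok` holds iff every term of the family is admissible (`c > 0`, `U < 1/2`). -/
theorem Cell.acc_ok_iff (C : Cell) (vs : List (ℤ × ℤ × ℤ)) :
    (C.acc vs).ok = true ↔ ∀ N ∈ vs, 0 < C.cOf N.1 N.2.1 N.2.2 ∧ C.UOf N.1 N.2.1 N.2.2 < 1 / 2 := by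
  unfold Cell.acc
  rw [C.foldl_ok vs Acc.init, Acc.init_ok, Bool.true_and, List.all_eq_true]
  simp [Cell.okTerm, Bool.and_eq_true, decide_eq_true_eq]

/-! ### Rounding envelopes of the contributions -/

/-- `lt_rdn_add` (docstring added by the landing lane; see the module docstring). [formal bookkeeping] -/
theorem lt_rdn_add {D : ℕ} (hD : 0 < D) (q : ℚ) : q < rdn D q + 1 / D := by
  unfold rdn
  have hD' : (0 : ℚ) < D := by exact_mod_cast hD
  rw [← add_div, lt_div_iff₀ hD']
  exact Int.lt_floor_add_one _

/-- `Cell.rc_le` (docstring added by the landing lane; see the module docstring). [formal bookkeeping] -/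
theorem Cell.rc_le (C : Cell) (hD : 0 < C.D) {N : ℤ × ℤ × ℤ} (hc : 0 < C.cOf N.1 N.2.1 N.2.2) (mo : Mono) (hd : mo.d < C.J) :
    C.rc N mo ≤ C.termQ N.1 N.2.1 N.2.2 mo ∧ C.termQ N.1 N.2.1 N.2.2 mo < C.rc N mo + 1 / C.D := by
  unfold Cell.rc
  rw [if_neg (not_le.mpr hc), if_pos hd]
  exact ⟨rdn_le hD _, lt_rdn_add hD _⟩

/-- `Cell.rc_of_ge` (docstring added by the landing lane; see the module docstring). [formal bookkeeping] -/
theorem Cell.rc_of_ge (C : Cell) {N : ℤ × ℤ × ℤ} (mo : Mono) (hd : ¬ mo.d < C.J) : C.rc N mo = 0 := by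
  unfold Cell.rc
  rw [if_neg hd]; split_ifs <;> rfl

/-- `Cell.le_rr` (docstring added by the landing lane; see the module docstring). [formal bookkeeping] -/
theorem Cell.le_rr (C : Cell) (hD : 0 < C.D) {N : ℤ × ℤ × ℤ} (hc : 0 < C.cOf N.1 N.2.1 N.2.2) :
    C.remQ N.1 N.2.1 N.2.2 ≤ C.rr N := by
  unfold Cell.rr
  rw [if_neg (not_le.mpr hc)]
  exact le_rup hD _

/-! ## §4 SOUNDNESS of a cell at order `J = 4`: the kernel polynomial encloses the true near sum on the whole box

Box point `t = (t1,…,t5)` (reals, `|t_i| ≤ h_i ≤ 1`); for the term `N` (cast coordinates `x y z`): `s_N(t) = c_N + ℓ_N(t)` with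
`ℓ_N(t) = Σ ℓ_i t_i` (`linR`).  The kernel polynomial is `evalCoef (C.acc vs).coef t = Σ_slots q_α t^α`.  Result (`acc_sound_m3_J4`,
`acc_sound_m6_J4`): `ok = true` ⇒ `|Σ_N s_N(t)^{-m} − evalCoef (C.acc vs).coef t| ≤ (C.acc vs).rem + 126 · |vs| / D`. -/

/-- Monomial evaluation. -/
def Mono.ev (mo : Mono) (a1 a2 a3 a4 a5 : ℝ) : ℝ :=
  a1 ^ mo.e1 * a2 ^ mo.e2 * a3 ^ mo.e3 * a4 ^ mo.e4 * a5 ^ mo.e5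

/-- The linear part `ℓ_N(t) = Σ ℓ_i t_i` of `s_N` at the box point `t`. -/
def Cell.linR (C : Cell) (x y z : ℚ) (t1 t2 t3 t4 t5 : ℝ) : ℝ :=
  (C.l1Of x y z : ℝ) * t1 + (C.l2Of x y z : ℝ) * t2 + (C.l3Of x y z : ℝ) * t3 + (C.l4Of x y z : ℝ) * t4 + (C.l5Of x y z : ℝ) * t5

/-- Evaluation of a coefficient list against the slot table `monos`. -/
def evalCoef (q : List ℚ) (t1 t2 t3 t4 t5 : ℝ) : ℝ :=
  (List.zipWith (fun (a : ℚ) (mo : Mono) => (a : ℝ) * mo.ev t1 t2 t3 t4 t5) q monos).sum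

/-- The exact order-4 model of one term as a polynomial in `t`: `Σ_{deg α < 4} termQ(α) t^α`. -/
def Cell.termModel (C : Cell) (x y z : ℚ) (t1 t2 t3 t4 t5 : ℝ) : ℝ :=
  (monos.map fun mo => (if mo.d < 4 then (C.termQ x y z mo : ℝ) else 0) * mo.ev t1 t2 t3 t4 t5).sum

/-- `tcoef_three_0` (docstring added by the landing lane; see the module docstring). [formal bookkeeping] -/
theorem tcoef_three_0 : tcoef 3 0 = 1 := by norm_num [tcoef]
/-- `tcoef_three_1` (docstring added by the landing lane; see the module docstring). [formal bookkeeping] -/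
theorem tcoef_three_1 : tcoef 3 1 = -3 := by norm_num [tcoef]
/-- `tcoef_three_2` (docstring added by the landing lane; see the module docstring). [formal bookkeeping] -/
theorem tcoef_three_2 : tcoef 3 2 = 6 := by norm_num [tcoef, Nat.choose]
/-- `tcoef_three_3` (docstring added by the landing lane; see the module docstring). [formal bookkeeping] -/
theorem tcoef_three_3 : tcoef 3 3 = -10 := by norm_num [tcoef, Nat.choose]
/-- `tcoef_six_0` (docstring added by the landing lane; see the module docstring). [formal bookkeeping] -/
theorem tcoef_six_0 : tcoef 6 0 = 1 := by norm_num [tcoef]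
/-- `tcoef_six_1` (docstring added by the landing lane; see the module docstring). [formal bookkeeping] -/
theorem tcoef_six_1 : tcoef 6 1 = -6 := by norm_num [tcoef]
/-- `tcoef_six_2` (docstring added by the landing lane; see the module docstring). [formal bookkeeping] -/
theorem tcoef_six_2 : tcoef 6 2 = 21 := by norm_num [tcoef, Nat.choose]
/-- `tcoef_six_3` (docstring added by the landing lane; see the module docstring). [formal bookkeeping] -/
theorem tcoef_six_3 : tcoef 6 3 = -56 := by norm_num [tcoef, Nat.choose]

set_option maxHeartbeats 8000000 in
/-- MULTINOMIAL REGROUPING (`m = 3`): the slot polynomial of one term IS `c^{-3} T_4(ℓ(t)/c)`. -/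
theorem Cell.termModel_eq_m3 (C : Cell) (hm : C.m = 3) (x y z : ℚ) (hc : C.cOf x y z ≠ 0) (t1 t2 t3 t4 t5 : ℝ) :
    C.termModel x y z t1 t2 t3 t4 t5 =
      ((C.cOf x y z : ℝ) ^ 3)⁻¹ * (1 - 3 * (C.linR x y z t1 t2 t3 t4 t5 / C.cOf x y z)
        + 6 * (C.linR x y z t1 t2 t3 t4 t5 / C.cOf x y z) ^ 2 - 10 * (C.linR x y z t1 t2 t3 t4 t5 / C.cOf x y z) ^ 3) := by
  have hc' : (C.cOf x y z : ℝ) ≠ 0 := by exact_mod_cast hc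
  simp only [Cell.termModel, monos, List.map_cons, List.map_nil, List.sum_cons, List.sum_nil, Cell.termQ, hm, Mono.ev,
    Cell.linR, tcoef_three_0, tcoef_three_1, tcoef_three_2, tcoef_three_3, Nat.reduceAdd, Nat.reduceLT, if_true, if_false,
    Nat.cast_ofNat, Nat.cast_one, Rat.cast_mul, Rat.cast_pow, Rat.cast_div, Rat.cast_one, Rat.cast_ofNat, Rat.cast_neg,
    pow_zero, pow_one, mul_one, one_mul, zero_mul, add_zero]
  field_simp
  ring

set_option maxHeartbeats 8000000 in
/-- MULTINOMIAL REGROUPING (`m = 6`). -/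
theorem Cell.termModel_eq_m6 (C : Cell) (hm : C.m = 6) (x y z : ℚ) (hc : C.cOf x y z ≠ 0) (t1 t2 t3 t4 t5 : ℝ) :
    C.termModel x y z t1 t2 t3 t4 t5 =
      ((C.cOf x y z : ℝ) ^ 6)⁻¹ * (1 - 6 * (C.linR x y z t1 t2 t3 t4 t5 / C.cOf x y z)
        + 21 * (C.linR x y z t1 t2 t3 t4 t5 / C.cOf x y z) ^ 2 - 56 * (C.linR x y z t1 t2 t3 t4 t5 / C.cOf x y z) ^ 3) := by
  have hc' : (C.cOf x y z : ℝ) ≠ 0 := by exact_mod_cast hc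
  simp only [Cell.termModel, monos, List.map_cons, List.map_nil, List.sum_cons, List.sum_nil, Cell.termQ, hm, Mono.ev,
    Cell.linR, tcoef_six_0, tcoef_six_1, tcoef_six_2, tcoef_six_3, Nat.reduceAdd, Nat.reduceLT, if_true, if_false,
    Nat.cast_ofNat, Nat.cast_one, Rat.cast_mul, Rat.cast_pow, Rat.cast_div, Rat.cast_one, Rat.cast_ofNat, Rat.cast_neg,
    pow_zero, pow_one, mul_one, one_mul, zero_mul, add_zero]
  field_simp
  ring

/-! ### Per-term enclosure on the box -/

/-- `|ℓ_N(t)/c| ≤ U` on the box `|t_i| ≤ h_i`. -/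
theorem Cell.linR_div_abs_le (C : Cell) (x y z : ℚ) (hc : 0 < C.cOf x y z) (t1 t2 t3 t4 t5 : ℝ)
    (h1 : |t1| ≤ C.h1) (h2 : |t2| ≤ C.h2) (h3 : |t3| ≤ C.h3) (h4 : |t4| ≤ C.h4) (h5 : |t5| ≤ C.h5) :
    |C.linR x y z t1 t2 t3 t4 t5 / C.cOf x y z| ≤ (C.UOf x y z : ℝ) := by
  have hc' : (0 : ℝ) < C.cOf x y z := by exact_mod_cast hc
  rw [abs_div, abs_of_pos hc', div_le_iff₀ hc']
  have hU : ((C.UOf x y z : ℚ) : ℝ) * (C.cOf x y z : ℝ) = |(C.l1Of x y z : ℝ)| * C.h1 + |(C.l2Of x y z : ℝ)| * C.h2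
      + |(C.l3Of x y z : ℝ)| * C.h3 + |(C.l4Of x y z : ℝ)| * C.h4 + |(C.l5Of x y z : ℝ)| * C.h5 := by
    unfold Cell.UOf
    push_cast
    rw [div_mul_cancel₀ _ hc'.ne']
  rw [hU]
  unfold Cell.linR
  have e1 : |(C.l1Of x y z : ℝ) * t1| ≤ |(C.l1Of x y z : ℝ)| * C.h1 := by
    rw [abs_mul]; exact mul_le_mul_of_nonneg_left h1 (abs_nonneg _)
  have e2 : |(C.l2Of x y z : ℝ) * t2| ≤ |(C.l2Of x y z : ℝ)| * C.h2 := by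
    rw [abs_mul]; exact mul_le_mul_of_nonneg_left h2 (abs_nonneg _)
  have e3 : |(C.l3Of x y z : ℝ) * t3| ≤ |(C.l3Of x y z : ℝ)| * C.h3 := by
    rw [abs_mul]; exact mul_le_mul_of_nonneg_left h3 (abs_nonneg _)
  have e4 : |(C.l4Of x y z : ℝ) * t4| ≤ |(C.l4Of x y z : ℝ)| * C.h4 := by
    rw [abs_mul]; exact mul_le_mul_of_nonneg_left h4 (abs_nonneg _)
  have e5 : |(C.l5Of x y z : ℝ) * t5| ≤ |(C.l5Of x y z : ℝ)| * C.h5 := by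
    rw [abs_mul]; exact mul_le_mul_of_nonneg_left h5 (abs_nonneg _)
  have a4 := abs_add_le ((C.l1Of x y z : ℝ) * t1 + (C.l2Of x y z : ℝ) * t2 + (C.l3Of x y z : ℝ) * t3 + (C.l4Of x y z : ℝ) * t4)
    ((C.l5Of x y z : ℝ) * t5)
  have a3 := abs_add_le ((C.l1Of x y z : ℝ) * t1 + (C.l2Of x y z : ℝ) * t2 + (C.l3Of x y z : ℝ) * t3) ((C.l4Of x y z : ℝ) * t4)
  have a2 := abs_add_le ((C.l1Of x y z : ℝ) * t1 + (C.l2Of x y z : ℝ) * t2) ((C.l3Of x y z : ℝ) * t3)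
  have a1 := abs_add_le ((C.l1Of x y z : ℝ) * t1) ((C.l2Of x y z : ℝ) * t2)
  linarith

/-- PER-TERM ENCLOSURE (`m = 3`, `J = 4`): on the box, the true term is within `remQ` of its slot polynomial. -/
theorem Cell.term_abs_m3 (C : Cell) (hm : C.m = 3) (hJ : C.J = 4) (x y z : ℚ) (hc : 0 < C.cOf x y z)
    (hU : C.UOf x y z < 1 / 2) (t1 t2 t3 t4 t5 : ℝ)
    (h1 : |t1| ≤ C.h1) (h2 : |t2| ≤ C.h2) (h3 : |t3| ≤ C.h3) (h4 : |t4| ≤ C.h4) (h5 : |t5| ≤ C.h5) :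
    |(((C.cOf x y z : ℝ) + C.linR x y z t1 t2 t3 t4 t5) ^ 3)⁻¹ - C.termModel x y z t1 t2 t3 t4 t5| ≤ (C.remQ x y z : ℝ) := by
  rw [C.termModel_eq_m3 hm x y z hc.ne' t1 t2 t3 t4 t5]
  have hc' : (0 : ℝ) < C.cOf x y z := by exact_mod_cast hc
  have hu := C.linR_div_abs_le x y z hc t1 t2 t3 t4 t5 h1 h2 h3 h4 h5
  have hU' : ((C.UOf x y z : ℚ) : ℝ) < 1 / 2 := by
    have := (Rat.cast_lt (K := ℝ)).2 hU
    simpa using this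
  have hη : ((C.UOf x y z : ℚ) : ℝ) < 1 := by linarith
  have hU0 : (0 : ℝ) ≤ C.UOf x y z := (abs_nonneg _).trans hu
  have key := term_model4_m3_abs hc' hη hu
  refine key.trans ?_
  have hrem : ((C.remQ x y z : ℚ) : ℝ) = ((C.cOf x y z : ℝ) ^ 3)⁻¹
      * ((C.UOf x y z : ℝ) ^ 4 * (15 + 24 * (C.UOf x y z : ℝ) + 10 * (C.UOf x y z : ℝ) ^ 2)
        / (1 - (C.UOf x y z : ℝ)) ^ 3) := by
    unfold Cell.remQ
    rw [hm, hJ]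
    simp only [remNum]
    push_cast
    ring
  rw [hrem]
  have h4' : |C.linR x y z t1 t2 t3 t4 t5 / C.cOf x y z| ^ 4 ≤ (C.UOf x y z : ℝ) ^ 4 := pow_le_pow_left₀ (abs_nonneg _) hu 4
  have hN : (0 : ℝ) ≤ 15 + 24 * (C.UOf x y z : ℝ) + 10 * (C.UOf x y z : ℝ) ^ 2 := by nlinarith
  have hd : (0 : ℝ) < (1 - (C.UOf x y z : ℝ)) ^ 3 := pow_pos (by linarith) 3
  exact mul_le_mul_of_nonneg_left (div_le_div_of_nonneg_right (mul_le_mul_of_nonneg_right h4' hN) hd.le) (by positivity)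

/-- PER-TERM ENCLOSURE (`m = 6`, `J = 4`). -/
theorem Cell.term_abs_m6 (C : Cell) (hm : C.m = 6) (hJ : C.J = 4) (x y z : ℚ) (hc : 0 < C.cOf x y z)
    (hU : C.UOf x y z < 1 / 2) (t1 t2 t3 t4 t5 : ℝ)
    (h1 : |t1| ≤ C.h1) (h2 : |t2| ≤ C.h2) (h3 : |t3| ≤ C.h3) (h4 : |t4| ≤ C.h4) (h5 : |t5| ≤ C.h5) :
    |(((C.cOf x y z : ℝ) + C.linR x y z t1 t2 t3 t4 t5) ^ 6)⁻¹ - C.termModel x y z t1 t2 t3 t4 t5| ≤ (C.remQ x y z : ℝ) := by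
  rw [C.termModel_eq_m6 hm x y z hc.ne' t1 t2 t3 t4 t5]
  have hc' : (0 : ℝ) < C.cOf x y z := by exact_mod_cast hc
  have hu := C.linR_div_abs_le x y z hc t1 t2 t3 t4 t5 h1 h2 h3 h4 h5
  have hU' : ((C.UOf x y z : ℚ) : ℝ) < 1 / 2 := by
    have := (Rat.cast_lt (K := ℝ)).2 hU
    simpa using this
  have hη : ((C.UOf x y z : ℚ) : ℝ) < 1 := by linarith
  have hU0 : (0 : ℝ) ≤ C.UOf x y z := (abs_nonneg _).trans hu
  have key := term_model4_m6_abs hc' hη hu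
  refine key.trans ?_
  have hrem : ((C.remQ x y z : ℚ) : ℝ) = ((C.cOf x y z : ℝ) ^ 6)⁻¹
      * ((C.UOf x y z : ℝ) ^ 4 * (126 + 504 * (C.UOf x y z : ℝ) + 840 * (C.UOf x y z : ℝ) ^ 2
          + 720 * (C.UOf x y z : ℝ) ^ 3 + 315 * (C.UOf x y z : ℝ) ^ 4 + 56 * (C.UOf x y z : ℝ) ^ 5)
        / (1 - (C.UOf x y z : ℝ)) ^ 6) := by
    unfold Cell.remQ
    rw [hm, hJ]
    simp only [remNum]
    push_cast
    ring
  rw [hrem]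
  have h4' : |C.linR x y z t1 t2 t3 t4 t5 / C.cOf x y z| ^ 4 ≤ (C.UOf x y z : ℝ) ^ 4 := pow_le_pow_left₀ (abs_nonneg _) hu 4
  have hN : (0 : ℝ) ≤ 126 + 504 * (C.UOf x y z : ℝ) + 840 * (C.UOf x y z : ℝ) ^ 2
      + 720 * (C.UOf x y z : ℝ) ^ 3 + 315 * (C.UOf x y z : ℝ) ^ 4 + 56 * (C.UOf x y z : ℝ) ^ 5 := by positivity
  have hd : (0 : ℝ) < (1 - (C.UOf x y z : ℝ)) ^ 6 := pow_pos (by linarith) 6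
  exact mul_le_mul_of_nonneg_left (div_le_div_of_nonneg_right (mul_le_mul_of_nonneg_right h4' hN) hd.le) (by positivity)

end Summit.AtomisticToContinuum.Crystallization.Theorems.OverbindingBudgetAffineTaylorCell
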